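import Mathlib
import HarnessLib
import Summits.HubbardSuperconductivity.HubbardSuperconductivity.Theorems.KLProgrammeKLRegimeTwoVolumeBlockDefectProfiles
import Summits.HubbardSuperconductivity.HubbardSuperconductivity.Theorems.KLProgrammeKLRegimeTwoVolumeGridGluing
import Summits.HubbardSuperconductivity.HubbardSuperconductivity.Theorems.KLProgrammeKLRegimeTwoVolumeGridPeriodisationLegs
import Literature.MathematicalPhysics.QuantumLattice.HubbardGridInteractionKernels
import Literature.MathematicalPhysics.QuantumLattice.HubbardTorusSingleScalePressure

/-!
# Route `KLProgramme` — crux K3, the nested two-volume pass (β′) ON THE MODEL: the grid-pulled-back normal covariance with a sampled symbol on the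
# nested tori `(ℤ/bL)² ⊃ b²` boxes `≅ (ℤ/L)²` and the on-site Hubbard grid interaction — fine action vs coarse action at a deep pin, from ONE-VOLUME DATA
# (cell gate-hubbard-kl, seat hubbard-kl-k3c4-p1 g7)

`…TwoVolumeBlockDefectProfiles.sum_norm_kernel_sub_copies_le_of_profile` instantiated: the block structure is `…TwoVolumeTorusBlocks.exists_gridLegBlockEquiv`
(boxes `⌊x/L⌋`, projection `red`), the zone is `{site not R-deep}`, `Far = R < tnorm (site − site)`, the coarse pseudo-distance is the torus distance of
the sites of `(ℤ/L)²`, (P) is `…TwoVolumeGridPeriodisationLegs.hubbardGridSub_pullback_periodise_leg`, (G1)/(G2) are `far_of_block_ne`/`far_of_fibre_ne`,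
the antisymmetry and charge selection of the grid pull-back are theorems, and the glued interaction IS the fine one (`…TwoVolumeGridGluing`).
The statement is `e`-FREE: the subtracted kernel is the COARSE kernel at the reduced legs times the indicator «all legs in the box of the pin leg».

* `tnorm_red_sub_gt_of_not_deep_of_deep` — a site that is not `R`-deep is at coarse torus distance `> R′` from an `(R + R′)`-deep site, after reduction;
* `isLabelDist_tnorm_site` — the coarse site torus distance of legs is a label pseudo-distance;
* **`hubbardGrid_sum_norm_kernel_sub_le`** — THE MODEL STEP: hypotheses = the symbol `F` (same at both volumes), `β ≠ 0`, `Lf = b·L`, depths `R, R′` and an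
  `(R+R′)`-deep pin, decay numbers of the two grid covariances (sups `s, s′`, row sums `α, α′`, torus first moments `m₁, m₁′`, the tail `T` of the fine one beyond
  torus distance `R`), charged Gram forms of both ((m3), UV lane), the coarse action's `(1 + diam)`-weighted all-degree pinned profile `Nw` with unit partition
  function ((E1)₀-type, coarse volume), and the two smallness conditions; conclusion: the pinned `L¹` distance, at the pin, between the degree-`(n+1)` kernels of
  `effAction C_{Lf} V_{Lf}` and the box-restricted reduced kernels of `effAction C_L V_L`, `V_V = hubbardGridInteraction V N β U + ν • hubbardGridQuadratic V N β`.

Sorry-free; no definition.  References: BETA-PRIME-ROADMAP.md (k3c5-p2 g5); VL-E3F-ROADMAP.md §3; BGM 2006 §2–§3; Salmhofer 1999 (2.102)–(2.106), §4.2.4.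
-/

noncomputable section

namespace Summit.HubbardSuperconductivity.HubbardSuperconductivity.Theorems.TwoVolumeDefect

set_option linter.dupNamespace false -- summit = problem name (single-conjunct summit), D-0017

open Finset Literature.MathematicalPhysics.QuantumLattice GrassmannAlgebra Literature.Probability.LatticeModels
  Literature.Probability.LatticeModels.BattleFederbush Summit.HubbardSuperconductivity.HubbardSuperconductivity.Theorems.TwoPointAssembly
open scoped Nat InnerProductSpace

/-! ## §1 Two more geometric facts -/

/-- **A non-deep site is far from a deep pin AFTER REDUCTION**: if `x` is not `R`-deep and `w` is `(R + R′)`-deep (boxes of side `L` in `(ℤ/Lf)^d`), then the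
coarse torus distance of the reductions is `> R′`. [folklore] -/
theorem tnorm_red_sub_gt_of_not_deep_of_deep {d L Lf : ℕ} [NeZero Lf] [NeZero L] {R R' : ℕ} {x w : TorusSite d Lf}
    (hx : ¬ ∀ j, R ≤ (x j).val % L ∧ (x j).val % L + R < L) (hw : ∀ j, R + R' ≤ (w j).val % L ∧ (w j).val % L + (R + R') < L) :
    R' < Torus.tnorm ((fun i => (((x i).val : ℕ) : ZMod L)) - fun i => (((w i).val : ℕ) : ZMod L)) := by
  push Not at hx
  obtain ⟨i, hi⟩ := hx
  have hu : ¬ (R ≤ ((((x i).val : ℕ) : ZMod L)).val ∧ ((((x i).val : ℕ) : ZMod L)).val + R < L) := by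
    rw [ZMod.val_natCast]; exact fun h => absurd (hi h.1) (not_le.2 h.2)
  have hv : R + R' ≤ ((((w i).val : ℕ) : ZMod L)).val ∧ ((((w i).val : ℕ) : ZMod L)).val + (R + R') < L := by
    rw [ZMod.val_natCast]; exact hw i
  have h1 := succ_le_natAbs_cRepZ_sub_of_not_deep hu hv
  have h2 := natAbs_cRepZ_apply_le_tnorm ((fun i => (((x i).val : ℕ) : ZMod L)) - fun i => (((w i).val : ℕ) : ZMod L)) i
  rw [Pi.sub_apply] at h2
  omega

/-- **The coarse site torus distance of grid legs is a label pseudo-distance.** [folklore] -/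
theorem isLabelDist_tnorm_site {L N : ℕ} [NeZero L] :
    IsLabelDist (fun Y₁ Y₂ : GridLeg (GridPoint L N) => (Torus.tnorm (Y₁.1.1.2 - Y₂.1.1.2) : ℝ)) where
  self Y := by simp [Torus.tnorm, Torus.cRep, Torus.cRepZ, Site.supNorm]
  symm Y₁ Y₂ := by rw [← neg_sub, Torus.tnorm_neg]
  nonneg Y₁ Y₂ := Nat.cast_nonneg _
  triangle Y₁ Y₂ Y₃ := by
    have h := Torus.tnorm_add_le (Y₁.1.1.2 - Y₂.1.1.2) (Y₂.1.1.2 - Y₃.1.1.2)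
    rw [sub_add_sub_cancel] at h
    exact_mod_cast h

/-! ## §2 The model step -/

/-- **THE NESTED TWO-VOLUME STEP ON THE MODEL, FROM ONE-VOLUME DATA.**  Grid legs over `(ℤ/Lf)²`, `Lf = b·L`; `C_V = Sᵀ (normalCovariance p_V) S` with
sampled symbols `p_V = (βV²)·F` at `V = L, Lf`; `V_V = hubbardGridInteraction V N β U + ν • hubbardGridQuadratic V N β`.  At an `(R + R′)`-deep pin
`w`, in every degree `n + 1`, the pinned `L¹` distance between the kernels of `effAction C_{Lf} V_{Lf}` and the box-restricted reduced kernels of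
`effAction C_L V_L` is bounded by the NEAR + FAR expression of `sum_norm_kernel_sub_copies_le_of_profile` with `dc` = coarse site torus distance,
`R_f = R′ + 1`, from: decay numbers `s, s′, α, α′, m₁, m₁′, T` of the two covariances, their charged Gram forms, the coarse action's weighted profile
`Nw` and unit partition function, the two smallness conditions, a nilpotency index `k` of the fine Laplacians (any linear order on the fine legs
serves the kernel bookkeeping). [folklore; BGM 2006 §2–§3; Salmhofer 1999 (2.102)–(2.106)] -/
theorem hubbardGrid_sum_norm_kernel_sub_le {b L Lf M N : ℕ} [NeZero Lf] [NeZero L] [LinearOrder (GridLeg (GridPoint Lf N))]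
    (hLf : Lf = b * L) {β : ℝ} (hβ : β ≠ 0)
    {E E' : Type*} [NormedAddCommGroup E] [InnerProductSpace ℂ E] [NormedAddCommGroup E'] [InnerProductSpace ℂ E']
    (F : MatsubaraIdx M → Fin 2 → (Fin 2 → ℝ) → ℂ) (pL : FreqMomentum L M × Fin 2 → ℂ) (pLf : FreqMomentum Lf M × Fin 2 → ℂ)
    (hpL : ∀ (k : FreqMomentum L M) (σ : Fin 2), pL (k, σ) = ((β * (L : ℝ) ^ 2 : ℝ) : ℂ) * F k.1 σ (latticeMomentum L k.2))
    (hpLf : ∀ (k : FreqMomentum Lf M) (σ : Fin 2), pLf (k, σ) = ((β * (Lf : ℝ) ^ 2 : ℝ) : ℂ) * F k.1 σ (latticeMomentum Lf k.2))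
    (CL : Matrix (GridLeg (GridPoint L N)) (GridLeg (GridPoint L N)) ℂ)
    (hCL : CL = (hubbardGridSub L M β N).transpose * normalCovariance L M pL * hubbardGridSub L M β N)
    (CLf : Matrix (GridLeg (GridPoint Lf N)) (GridLeg (GridPoint Lf N)) ℂ)
    (hCLf : CLf = (hubbardGridSub Lf M β N).transpose * normalCovariance Lf M pLf * hubbardGridSub Lf M β N)
    -- depth of the zone, extra depth of the pin, the pin
    (R R' : ℕ) (w : GridLeg (GridPoint Lf N)) (hw : ∀ j, R + R' ≤ (w.1.1.2 j).val % L ∧ (w.1.1.2 j).val % L + (R + R') < L)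
    -- decay numbers of the two covariances
    {T : ℝ} (hT0 : 0 < T) (hT : ∀ X', ∑ Y' ∈ univ.filter (fun Y' : GridLeg (GridPoint Lf N) => R < Torus.tnorm (X'.1.1.2 - Y'.1.1.2)), ‖CLf X' Y'‖ ≤ T)
    {s s' : ℝ} (hs0 : 0 ≤ s) (hs'0 : 0 ≤ s') (hs : ∀ X Y, ‖CL X Y‖ ≤ s) (hs' : ∀ X' Y', ‖CLf X' Y'‖ ≤ s')
    {α α' : ℝ} (hαα : 0 < α' + α) (hrow : ∀ X, ∑ Y, ‖CL X Y‖ ≤ α) (hrow' : ∀ X', ∑ Y', ‖CLf X' Y'‖ ≤ α')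
    {m₁ m₁' : ℝ} (hm0 : 0 ≤ m₁) (hm0' : 0 ≤ m₁')
    (hm1 : ∀ X, ∑ Y, ‖CL X Y‖ * (Torus.tnorm (X.1.1.2 - Y.1.1.2) : ℝ) ≤ m₁)
    (hm1' : ∀ X', ∑ Y', ‖CLf X' Y'‖ *
      (Torus.tnorm ((fun i => (((X'.1.1.2 i).val : ℕ) : ZMod L)) - fun i => (((Y'.1.1.2 i).val : ℕ) : ZMod L)) : ℝ) ≤ m₁')
    -- charged Gram forms of the two covariances (charge `0` rows, charge `1` columns)
    (f g : GridLeg (GridPoint L N) → E) (f' g' : GridLeg (GridPoint Lf N) → E') {κ κ' κD : ℝ} (hκD0 : 0 < κD)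
    (hκD : Real.sqrt (κ' ^ 2 + κ ^ 2) ≤ κD)
    (hf : ∀ X, X.2 = 0 → ‖f X‖ ≤ κ) (hg : ∀ Y, Y.2 ≠ 0 → ‖g Y‖ ≤ κ)
    (hf' : ∀ X', X'.2 = 0 → ‖f' X'‖ ≤ κ') (hg' : ∀ Y', Y'.2 ≠ 0 → ‖g' Y'‖ ≤ κ')
    (hG : ∀ X Y, X.2 = 0 → Y.2 ≠ 0 → contr ℂ CL X Y = ⟪f X, g Y⟫_ℂ)
    (hG' : ∀ X' Y', X'.2 = 0 → Y'.2 ≠ 0 → contr ℂ CLf X' Y' = ⟪f' X', g' Y'⟫_ℂ)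
    -- the interactions
    (U : ℝ) (ν : ℂ) (hZ : IsUnit (effPartitionFn ℂ CL (hubbardGridInteraction L N β U + ν • hubbardGridQuadratic L N β)))
    -- the coarse weighted profile and the smallness conditions
    (Nw : ℕ → ℝ) (hNw0 : ∀ m, 0 ≤ Nw m)
    (hNw : ∀ (m' : ℕ) (j : Fin (2 * m')) (x : GridLeg (GridPoint L N)),
      ∑ Y ∈ univ.filter (fun Y : Fin (2 * m') → GridLeg (GridPoint L N) => Y j = x),
        ‖kernel ℂ (effAction ℂ CL (hubbardGridInteraction L N β U + ν • hubbardGridQuadratic L N β)) (2 * m') Y‖ *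
          (1 + labelDiam (fun Y₁ Y₂ : GridLeg (GridPoint L N) => (Torus.tnorm (Y₁.1.1.2 - Y₂.1.1.2) : ℝ)) (univ.image Y)) ≤ Nw m')
    {ρf : ℝ} (hρf : 0 < ρf)
    (hθw : Real.exp 1 * (α' + α + (m₁' + m₁)) * normV (GridLeg (GridPoint Lf N)) κD ρf Nw / κD ^ 2 < 1)
    {ρn : ℝ} (hρn : 0 < ρn)
    (hθn : Real.exp 1 * (2 * T) * normV (GridLeg (GridPoint Lf N)) (Real.sqrt (κD ^ 2 + κD ^ 2)) ρn
        (fun m' => ρf⁻¹ ^ (2 * m') * (Real.exp 1 * normV (GridLeg (GridPoint Lf N)) κD ρf Nw) /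
          (1 - Real.exp 1 * (α' + α + (m₁' + m₁)) * normV (GridLeg (GridPoint Lf N)) κD ρf Nw / κD ^ 2)) /
        Real.sqrt (κD ^ 2 + κD ^ 2) ^ 2 < 1)
    {k : ℕ} (hk : ∀ D : Matrix (GridLeg (GridPoint Lf N)) (GridLeg (GridPoint Lf N)) ℂ, grassmannLaplacian ℂ D ^ k = 0)
    (n : ℕ) (p : Fin (n + 1)) :
    ∑ X ∈ univ.filter (fun X : Fin (n + 1) → GridLeg (GridPoint Lf N) => X p = w),
        ‖kernel ℂ (effAction ℂ CLf (hubbardGridInteraction Lf N β U + ν • hubbardGridQuadratic Lf N β)) (n + 1) X -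
          (if ∀ i j, ((X i).1.1.2 j).val / L = ((X p).1.1.2 j).val / L then
            kernel ℂ (effAction ℂ CL (hubbardGridInteraction L N β U + ν • hubbardGridQuadratic L N β)) (n + 1)
              (fun i => ((((X i).1.1.1, fun j => ((((X i).1.1.2 j).val : ℕ) : ZMod L)), (X i).1.2), (X i).2))
          else 0)‖ ≤
      (∑ j ∈ Ico 1 k, ((n + 1 + 2 * j)! : ℝ) / (((n + 1) ! : ℝ) * (j ! : ℝ) * 2 ^ j) * T ^ j *
            (ρf⁻¹ ^ (n + 1 + 2 * j) * (Real.exp 1 * normV (GridLeg (GridPoint Lf N)) κD ρf Nw) /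
              (1 - Real.exp 1 * (α' + α + (m₁' + m₁)) * normV (GridLeg (GridPoint Lf N)) κD ρf Nw / κD ^ 2)) +
          ρn⁻¹ ^ (n + 1) * (Real.exp 1 * normV (GridLeg (GridPoint Lf N)) (Real.sqrt (κD ^ 2 + κD ^ 2)) ρn
            (fun m' => ρf⁻¹ ^ (2 * m') * (Real.exp 1 * normV (GridLeg (GridPoint Lf N)) κD ρf Nw) /
              (1 - Real.exp 1 * (α' + α + (m₁' + m₁)) * normV (GridLeg (GridPoint Lf N)) κD ρf Nw / κD ^ 2))) *
            (Real.exp 1 * (2 * T) * normV (GridLeg (GridPoint Lf N)) (Real.sqrt (κD ^ 2 + κD ^ 2)) ρn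
                (fun m' => ρf⁻¹ ^ (2 * m') * (Real.exp 1 * normV (GridLeg (GridPoint Lf N)) κD ρf Nw) /
                  (1 - Real.exp 1 * (α' + α + (m₁' + m₁)) * normV (GridLeg (GridPoint Lf N)) κD ρf Nw / κD ^ 2)) /
                Real.sqrt (κD ^ 2 + κD ^ 2) ^ 2) /
              (1 - Real.exp 1 * (2 * T) * normV (GridLeg (GridPoint Lf N)) (Real.sqrt (κD ^ 2 + κD ^ 2)) ρn
                (fun m' => ρf⁻¹ ^ (2 * m') * (Real.exp 1 * normV (GridLeg (GridPoint Lf N)) κD ρf Nw) /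
                  (1 - Real.exp 1 * (α' + α + (m₁' + m₁)) * normV (GridLeg (GridPoint Lf N)) κD ρf Nw / κD ^ 2)) /
                Real.sqrt (κD ^ 2 + κD ^ 2) ^ 2)) +
        ((((n + 1 + 1) * (n + 1 + 2) : ℕ) : ℝ) / 2 * ((s' + s) / ((R' : ℝ) + 1)) *
            (ρf⁻¹ ^ (n + 3) * (Real.exp 1 * normV (GridLeg (GridPoint Lf N)) κD ρf Nw) /
              (1 - Real.exp 1 * (α' + α + (m₁' + m₁)) * normV (GridLeg (GridPoint Lf N)) κD ρf Nw / κD ^ 2)) +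
          ‖(2 : ℂ)⁻¹‖ * ∑ a ∈ range (n + 2), ∑ b' ∈ range (n + 2),
            (if a + b' = n + 1 then (((a + 1) * (b' + 1) : ℕ) : ℝ) *
              ((α' + α) *
                  (ρf⁻¹ ^ (a + 1) * (Real.exp 1 * normV (GridLeg (GridPoint Lf N)) κD ρf Nw) /
                      (1 - Real.exp 1 * (α' + α + (m₁' + m₁)) * normV (GridLeg (GridPoint Lf N)) κD ρf Nw / κD ^ 2) / ((R' : ℝ) + 1)) *
                  (ρf⁻¹ ^ (b' + 1) * (Real.exp 1 * normV (GridLeg (GridPoint Lf N)) κD ρf Nw) /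
                    (1 - Real.exp 1 * (α' + α + (m₁' + m₁)) * normV (GridLeg (GridPoint Lf N)) κD ρf Nw / κD ^ 2)) +
                (α' + α) *
                  (ρf⁻¹ ^ (a + 1) * (Real.exp 1 * normV (GridLeg (GridPoint Lf N)) κD ρf Nw) /
                    (1 - Real.exp 1 * (α' + α + (m₁' + m₁)) * normV (GridLeg (GridPoint Lf N)) κD ρf Nw / κD ^ 2)) *
                  (ρf⁻¹ ^ (b' + 1) * (Real.exp 1 * normV (GridLeg (GridPoint Lf N)) κD ρf Nw) /
                      (1 - Real.exp 1 * (α' + α + (m₁' + m₁)) * normV (GridLeg (GridPoint Lf N)) κD ρf Nw / κD ^ 2) / ((R' : ℝ) + 1))) else 0)) := by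
  -- the block structure of the grid legs
  obtain ⟨e, he1, he2⟩ := exists_gridLegBlockEquiv hLf N
  -- a block embedding per box
  set Fe : (Fin 2 → Fin b) → (GridLeg (GridPoint L N) → ℂ) →ₗ[ℂ] (GridLeg (GridPoint Lf N) → ℂ) := fun β' =>
    LinearMap.pi (fun X' : GridLeg (GridPoint Lf N) => if (e X').1 = β' then
      (LinearMap.proj (e X').2 : (GridLeg (GridPoint L N) → ℂ) →ₗ[ℂ] ℂ) else 0) with hFe_def
  have hFe : ∀ β' v X', Fe β' v X' = if (e X').1 = β' then v (e X').2 else 0 := fun β' v X' => blockEmb_pi_apply ℂ e β' v X'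
  -- the pieces
  set Ccop : Matrix (GridLeg (GridPoint Lf N)) (GridLeg (GridPoint Lf N)) ℂ :=
    Matrix.of fun X' Y' => if (e X').1 = (e Y').1 then CL (e X').2 (e Y').2 else 0 with hCcop_def
  set Zs : Set (GridLeg (GridPoint Lf N)) := {X' | ¬ ∀ j, R ≤ (X'.1.1.2 j).val % L ∧ (X'.1.1.2 j).val % L + R < L} with hZs_def
  set Df : Matrix (GridLeg (GridPoint Lf N)) (GridLeg (GridPoint Lf N)) ℂ :=
    Matrix.of fun X' Y' => if X' ∈ Zs ∧ Y' ∈ Zs then CLf X' Y' - Ccop X' Y' else 0 with hDf_def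
  set Dn : Matrix (GridLeg (GridPoint Lf N)) (GridLeg (GridPoint Lf N)) ℂ :=
    Matrix.of fun X' Y' => if X' ∈ Zs ∧ Y' ∈ Zs then 0 else CLf X' Y' - Ccop X' Y' with hDn_def
  have hCcop : ∀ X' Y', Ccop X' Y' = if (e X').1 = (e Y').1 then CL (e X').2 (e Y').2 else 0 := fun X' Y' => rfl
  have hDf : ∀ X' Y', Df X' Y' = if X' ∈ Zs ∧ Y' ∈ Zs then CLf X' Y' - Ccop X' Y' else 0 := fun X' Y' => rfl
  have hDn : ∀ X' Y', Dn X' Y' = if X' ∈ Zs ∧ Y' ∈ Zs then 0 else CLf X' Y' - Ccop X' Y' := fun X' Y' => rfl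
  -- (P) periodisation, antisymmetry, charge selection of the grid pull-backs
  have hP : ∀ (X' : GridLeg (GridPoint Lf N)) (Y : GridLeg (GridPoint L N)),
      ∑ Y'' ∈ univ.filter (fun Y'' : GridLeg (GridPoint Lf N) => (e Y'').2 = Y), CLf X' Y'' = CL (e X').2 Y := by
    intro X' Y
    rw [hCL, hCLf]
    exact hubbardGridSub_pullback_periodise_leg hLf hβ N F pL pLf hpL hpLf e he2 X' Y
  have hCt : ∀ X Y, CL Y X = -CL X Y := fun X Y => by rw [hCL]; exact hubbardGridSub_pullback_swap β N pL X Y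
  have hC't : ∀ X' Y', CLf Y' X' = -CLf X' Y' := fun X' Y' => by rw [hCLf]; exact hubbardGridSub_pullback_swap β N pLf X' Y'
  have hCq : ∀ X Y : GridLeg (GridPoint L N), (decide (X.2 = 0)) = (decide (Y.2 = 0)) → CL X Y = 0 := by
    intro X Y h
    rw [hCL]
    refine hubbardGridSub_pullback_apply_of_charge_eq β N pL ?_
    have h' : X.2 = 0 ↔ Y.2 = 0 := by simpa using h
    rcases Fin.eq_zero_or_eq_succ (n := 1) X.2 with hX | ⟨j, hX⟩ <;> rcases Fin.eq_zero_or_eq_succ (n := 1) Y.2 with hY | ⟨j', hY⟩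
    · rw [hX, hY]
    · exact absurd (h'.1 hX) (by rw [hY]; exact Fin.succ_ne_zero j')
    · exact absurd (h'.2 hY) (by rw [hX]; exact Fin.succ_ne_zero j)
    · rw [hX, hY, Fin.eq_zero j, Fin.eq_zero j']
  have hC'q : ∀ X' Y' : GridLeg (GridPoint Lf N), (decide ((e X').2.2 = 0)) = (decide ((e Y').2.2 = 0)) → CLf X' Y' = 0 := by
    intro X' Y' h
    rw [he2, he2] at h
    rw [hCLf]
    refine hubbardGridSub_pullback_apply_of_charge_eq β N pLf ?_
    have h' : X'.2 = 0 ↔ Y'.2 = 0 := by simpa using h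
    rcases Fin.eq_zero_or_eq_succ (n := 1) X'.2 with hX | ⟨j, hX⟩ <;> rcases Fin.eq_zero_or_eq_succ (n := 1) Y'.2 with hY | ⟨j', hY⟩
    · rw [hX, hY]
    · exact absurd (h'.1 hX) (by rw [hY]; exact Fin.succ_ne_zero j')
    · exact absurd (h'.2 hY) (by rw [hX]; exact Fin.succ_ne_zero j)
    · rw [hX, hY, Fin.eq_zero j, Fin.eq_zero j']
  -- the glued interaction is the fine one
  have hglue : ∑ β', ExteriorAlgebra.map (Fe β') (hubbardGridInteraction L N β U + ν • hubbardGridQuadratic L N β) =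
      hubbardGridInteraction Lf N β U + ν • hubbardGridQuadratic Lf N β := by
    simp only [map_add, map_smul, sum_add_distrib, ← Finset.smul_sum]
    rw [sum_map_blockEmb_hubbardGridInteraction e he1 he2 Fe hFe, sum_map_blockEmb_hubbardGridQuadratic e he1 he2 Fe hFe]
  have hglue' : ∑ β', ExteriorAlgebra.map (Fe β') (effAction ℂ CL (hubbardGridInteraction L N β U + ν • hubbardGridQuadratic L N β)) =
      effAction ℂ Ccop (hubbardGridInteraction Lf N β U + ν • hubbardGridQuadratic Lf N β) := by
    rw [← hglue]
    exact ((effAction_copies_sum e CL Ccop hCcop Fe hFe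
      ((mem_evenPart_iff).1 (add_mem (hubbardGridInteraction_mem_evenPart β U)
        (Subalgebra.smul_mem _ (hubbardGridQuadratic_mem_evenPart β) ν)))
      (by rw [map_add, map_smul, constPart_hubbardGridInteraction, constPart_hubbardGridQuadratic, smul_zero, add_zero]) hZ univ).2).symm
  -- the e-free reading of the subtracted kernel
  have hsub : ∀ X : Fin (n + 1) → GridLeg (GridPoint Lf N),
      kernel ℂ (∑ β', ExteriorAlgebra.map (Fe β') (effAction ℂ CL (hubbardGridInteraction L N β U + ν • hubbardGridQuadratic L N β))) (n + 1) X =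
        if ∀ i j, ((X i).1.1.2 j).val / L = ((X p).1.1.2 j).val / L then
          kernel ℂ (effAction ℂ CL (hubbardGridInteraction L N β U + ν • hubbardGridQuadratic L N β)) (n + 1)
            (fun i => ((((X i).1.1.1, fun j => ((((X i).1.1.2 j).val : ℕ) : ZMod L)), (X i).1.2), (X i).2))
        else 0 := by
    intro X
    rw [kernel_copies_sum e Fe hFe _ p X]
    have hiff : (∀ i, (e (X i)).1 = (e (X p)).1) ↔ ∀ i j, ((X i).1.1.2 j).val / L = ((X p).1.1.2 j).val / L := by
      refine ⟨fun h i j => ?_, fun h i => funext fun j => Fin.ext ?_⟩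
      · rw [← he1, ← he1, h i]
      · rw [he1, he1]; exact h i j
    have hproj : (fun i => (e (X i)).2) = fun i => ((((X i).1.1.1, fun j => ((((X i).1.1.2 j).val : ℕ) : ZMod L)), (X i).1.2), (X i).2) :=
      funext fun i => he2 (X i)
    by_cases h : ∀ i j, ((X i).1.1.2 j).val / L = ((X p).1.1.2 j).val / L
    · rw [if_pos (hiff.2 h), if_pos h, hproj]
    · rw [if_neg (fun h' => h (hiff.1 h')), if_neg h]
  simp_rw [← hsub, ← hglue]
  -- geometry: (G1), (G2), the pin is far from the zone in the coarse distance
  have hG1 : ∀ X' Y', (e X').1 ≠ (e Y').1 → ¬ (X' ∈ Zs ∧ Y' ∈ Zs) → R < Torus.tnorm (X'.1.1.2 - Y'.1.1.2) :=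
    fun X' Y' hne hnz => far_of_block_ne hLf e he1 hne hnz
  have hG2 : ∀ X' Y' Y'', (e X').1 = (e Y').1 → (e Y'').2 = (e Y').2 → Y'' ≠ Y' → ¬ (X' ∈ Zs ∧ Y' ∈ Zs) →
      R < Torus.tnorm (X'.1.1.2 - Y''.1.1.2) :=
    fun X' Y' Y'' hb hf hn hnz => far_of_fibre_ne hLf e he1 he2 hb hf hn hnz
  have hdR : ∀ X, X ∈ Zs → (R' : ℝ) + 1 ≤
      (fun Y₁ Y₂ : GridLeg (GridPoint L N) => (Torus.tnorm (Y₁.1.1.2 - Y₂.1.1.2) : ℝ)) (e X).2 (e w).2 := by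
    intro X hX
    have h := tnorm_red_sub_gt_of_not_deep_of_deep (L := L) hX hw
    dsimp only
    rw [he2, he2]
    exact_mod_cast Nat.succ_le_of_lt h
  -- the first moment of the fine covariance in the pulled-back coarse distance
  have hm1'' : ∀ X', ∑ Y', ‖CLf X' Y'‖ *
      (fun Y₁ Y₂ : GridLeg (GridPoint L N) => (Torus.tnorm (Y₁.1.1.2 - Y₂.1.1.2) : ℝ)) (e X').2 (e Y').2 ≤ m₁' := by
    intro X'
    refine le_trans (le_of_eq (sum_congr rfl fun Y' _ => ?_)) (hm1' X')
    dsimp only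
    rw [he2, he2]
  -- charges through the projection
  have hq2 : ∀ X' : GridLeg (GridPoint Lf N), (e X').2.2 = X'.2 := fun X' => by rw [he2]
  -- parity / constant part of the coarse interaction
  have hVe : hubbardGridInteraction L N β U + ν • hubbardGridQuadratic L N β ∈ evenOdd ℂ 0 :=
    (mem_evenPart_iff).1 (add_mem (hubbardGridInteraction_mem_evenPart β U) (Subalgebra.smul_mem _ (hubbardGridQuadratic_mem_evenPart β) ν))
  have hV0 : constPart ℂ (hubbardGridInteraction L N β U + ν • hubbardGridQuadratic L N β) = 0 := by
    rw [map_add, map_smul, constPart_hubbardGridInteraction, constPart_hubbardGridQuadratic, smul_zero, add_zero]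
  have hmain := sum_norm_kernel_sub_copies_le_of_profile e CL CLf Ccop Dn Df Zs hCcop hDf hDn hP
    (fun X' Y' => R < Torus.tnorm (X'.1.1.2 - Y'.1.1.2)) hG1 hG2 hT0 hT hCt hC't hs0 hs'0 hs hs' hαα hrow hrow'
    (fun Y₁ Y₂ : GridLeg (GridPoint L N) => (Torus.tnorm (Y₁.1.1.2 - Y₂.1.1.2) : ℝ)) isLabelDist_tnorm_site hm0 hm0' hm1 hm1''
    (fun Y : GridLeg (GridPoint L N) => decide (Y.2 = 0)) hCq hC'q f g f' g' hκD0 hκD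
    (fun X hX => hf X (of_decide_eq_true hX)) (fun Y hY => hg Y (of_decide_eq_false hY))
    (fun X' hX => hf' X' (by rw [← hq2]; exact of_decide_eq_true hX))
    (fun Y' hY => hg' Y' (by rw [← hq2]; exact of_decide_eq_false hY))
    (fun X Y hX hY => hG X Y (of_decide_eq_true hX) (of_decide_eq_false hY))
    (fun X' Y' hX hY => hG' X' Y' (by rw [← hq2]; exact of_decide_eq_true hX) (by rw [← hq2]; exact of_decide_eq_false hY))
    (by positivity) w hdR Fe hFe hVe hV0 hZ Nw hNw0 hNw hρf hθw hρn hθn (hk Dn) n p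
  convert hmain using 3

end Summit.HubbardSuperconductivity.HubbardSuperconductivity.Theorems.TwoVolumeDefect

end
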